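import Mathlib
import Summits.Ventures.PercRepro2.HCov
import Summits.Ventures.PercRepro2.CCTRootEdge
import Summits.Ventures.PercRepro2.EdgeCubic
import Summits.Ventures.PercRepro2.CPolarA3
import Summits.Ventures.PercRepro2.CPolarA3Marks
import Summits.Ventures.PercRepro2.PendantClusterPins

/-!
# A pendant `a₃`-cluster: the masses of `EdgeLine.B1` / `B2` at the two pins, almost surely
(blind cell PercRepro2, p5 g15; `proofs/P5-OEDGE.md` §17)

The almost-sure twins of PendantA3Pins' `prob_zero_*` / `prob_one_*` (`prob_zero_PD_ae`, …,
`prob_one_Q_ae`): when `f = {z, u}` is the only fractional edge touching the mark-free reach `K` of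
`a₃`, at `p[f↦0]` the masses of `PD`, `T`, `T′` collapse onto `Q`, `∅`, `∅` and at `p[f↦1]` onto the
worlds `PD_u`, `T_u`, `T′_u` of the instance with `a₃ := u`, by `prob_congr_of_weight` on the pinned
connectivity of PendantClusterPins.lean; `pins_zero_cluster` / `pins_one_cluster` collect the twelve
masses of `B1` / `B2` at each pin.
-/

namespace Summit.Ventures.PercRepro2

open UnionCluster CovForm CovForm.CPolarA3

namespace PendantCluster

/-! ## The masses at the two pins, almost surely -/

section Masses

variable {V : Type*} {E : Type*} [Fintype E] [DecidableEq E] {R : Type*} [Field R]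
  [LinearOrder R]

variable (p : E → R) {ends : E → Sym2 V} {f : E} {a₃ z u : V} (a₁ a₂ : V)
  (hK : ∀ e ∈ fracEdges p, TouchesReach p ends a₃ e → e = f)
  (hf : ends f = s(z, u)) (hz : z ∈ pinnedReach p ends a₃) (hu : u ∉ pinnedReach p ends a₃)
  (hf1 : p f ≠ 1) (h1 : a₁ ∉ pinnedReach p ends a₃) (h2 : a₂ ∉ pinnedReach p ends a₃)

include hK hf hz hu hf1 h1 h2

open CCT

/-- Pinned closed: `P(PD ∩ X) = P(Q ∩ X)`. -/
lemma prob_zero_PD_ae {X : Set (Config E)} (hX : FreeAE p f X) :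
    prob (Function.update p f 0) (PDEvent ends a₁ a₂ a₃ ∩ X) =
      prob p (avoidAll ends a₂ {a₁} ∩ X) := by
  rw [prob_update_zero_eq]
  refine prob_congr_of_weight p _ _ fun ω hw => ?_
  have hQ := freeAE_Q hK hf hz hu hf1 h1 h2 ω hw false
  have hXm := hX ω hw false
  have c12 := conn_update_iff hK hf hz hu hf1 hw h1 h2 false
  simp only [Set.mem_setOf_eq, Set.mem_inter_iff, PDEvent, Dtilde, Set.mem_compl_iff, mem_inU,
    mem_connEvent]
  simp only [mem_avoidAll, Finset.mem_singleton, forall_eq] at hQ ⊢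
  constructor
  · rintro ⟨⟨h12, _⟩, hx⟩
    exact ⟨fun h => h12 (c12.2 (conn_symm h)), hXm.1 hx⟩
  · rintro ⟨h21, hx⟩
    refine ⟨⟨fun h => h21 (conn_symm (c12.1 h)), ?_⟩, hXm.2 hx⟩
    rintro (h | h)
    · exact not_conn_update_false_a3 hK hf1 hw h1 h
    · exact not_conn_update_false_a3 hK hf1 hw h2 h

omit h1 hf hz hu in
/-- Pinned closed: `P(T ∩ X) = 0`. -/
lemma prob_zero_T_ae (X : Set (Config E)) :
    prob (Function.update p f 0) (TEvent ends a₁ a₂ a₃ ∩ X) = 0 := by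
  rw [prob_update_zero_eq]
  refine prob_eq_zero_of_weight_eq_zero p _ fun ω hω => ?_
  by_contra hw
  have := hω.1
  simp only [TEvent, Set.mem_inter_iff, Set.mem_compl_iff, mem_connEvent] at this
  exact not_conn_update_false_a3 hK hf1 hw h2 (conn_symm this.2)

omit h2 hf hz hu in
/-- Pinned closed: `P(T′ ∩ X) = 0`. -/
lemma prob_zero_T'_ae (X : Set (Config E)) :
    prob (Function.update p f 0) (TEvent ends a₂ a₁ a₃ ∩ X) = 0 := by
  rw [prob_update_zero_eq]
  refine prob_eq_zero_of_weight_eq_zero p _ fun ω hω => ?_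
  by_contra hw
  have := hω.1
  simp only [TEvent, Set.mem_inter_iff, Set.mem_compl_iff, mem_connEvent] at this
  exact not_conn_update_false_a3 hK hf1 hw h1 (conn_symm this.2)

/-- Pinned open: `P(PD ∩ X) = P(PD_u ∩ X)`. -/
lemma prob_one_PD_ae {X : Set (Config E)} (hX : FreeAE p f X) :
    prob (Function.update p f 1) (PDEvent ends a₁ a₂ a₃ ∩ X) =
      prob p (PDEvent ends a₁ a₂ u ∩ X) := by
  rw [prob_update_one_eq]
  refine prob_congr_of_weight p _ _ fun ω hw => ?_
  have hXm := hX ω hw true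
  have c12 := conn_update_iff hK hf hz hu hf1 hw h1 h2 true
  have cu1 := conn_update_iff hK hf hz hu hf1 hw hu h1 true
  have cu2 := conn_update_iff hK hf hz hu hf1 hw hu h2 true
  have h3u := conn_update_true_a3_u hf hz hw
  simp only [Set.mem_setOf_eq, Set.mem_inter_iff, PDEvent, Dtilde, Set.mem_compl_iff, mem_inU,
    mem_connEvent]
  constructor
  · rintro ⟨⟨hQ, hU⟩, hx⟩
    refine ⟨⟨fun h => hQ (c12.2 h), ?_⟩, hXm.1 hx⟩
    rintro (h | h)
    · exact hU (Or.inl (conn_trans h3u (cu1.2 h)))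
    · exact hU (Or.inr (conn_trans h3u (cu2.2 h)))
  · rintro ⟨⟨hQ, hU⟩, hx⟩
    refine ⟨⟨fun h => hQ (c12.1 h), ?_⟩, hXm.2 hx⟩
    rintro (h | h)
    · exact hU (Or.inl (cu1.1 (conn_trans (conn_symm h3u) h)))
    · exact hU (Or.inr (cu2.1 (conn_trans (conn_symm h3u) h)))

/-- Pinned open: `P(T ∩ X) = P(T_u ∩ X)`. -/
lemma prob_one_T_ae {X : Set (Config E)} (hX : FreeAE p f X) :
    prob (Function.update p f 1) (TEvent ends a₁ a₂ a₃ ∩ X) =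
      prob p (TEvent ends a₁ a₂ u ∩ X) := by
  rw [prob_update_one_eq]
  refine prob_congr_of_weight p _ _ fun ω hw => ?_
  have hXm := hX ω hw true
  have c21 := conn_update_iff hK hf hz hu hf1 hw h2 h1 true
  have c2u := conn_update_iff hK hf hz hu hf1 hw h2 hu true
  have h3u := conn_update_true_a3_u hf hz hw
  simp only [Set.mem_setOf_eq, Set.mem_inter_iff, TEvent, Set.mem_compl_iff, mem_connEvent]
  constructor
  · rintro ⟨⟨hQ, h23⟩, hx⟩
    exact ⟨⟨fun h => hQ (c21.2 h), c2u.1 (conn_trans h23 h3u)⟩, hXm.1 hx⟩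
  · rintro ⟨⟨hQ, h2u⟩, hx⟩
    exact ⟨⟨fun h => hQ (c21.1 h), conn_trans (c2u.2 h2u) (conn_symm h3u)⟩, hXm.2 hx⟩

/-- Pinned open: `P(T′ ∩ X) = P(T′_u ∩ X)`. -/
lemma prob_one_T'_ae {X : Set (Config E)} (hX : FreeAE p f X) :
    prob (Function.update p f 1) (TEvent ends a₂ a₁ a₃ ∩ X) =
      prob p (TEvent ends a₂ a₁ u ∩ X) := by
  rw [prob_update_one_eq]
  refine prob_congr_of_weight p _ _ fun ω hw => ?_
  have hXm := hX ω hw true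
  have c12 := conn_update_iff hK hf hz hu hf1 hw h1 h2 true
  have c1u := conn_update_iff hK hf hz hu hf1 hw h1 hu true
  have h3u := conn_update_true_a3_u hf hz hw
  simp only [Set.mem_setOf_eq, Set.mem_inter_iff, TEvent, Set.mem_compl_iff, mem_connEvent]
  constructor
  · rintro ⟨⟨hQ, h13⟩, hx⟩
    exact ⟨⟨fun h => hQ (c12.2 h), c1u.1 (conn_trans h13 h3u)⟩, hXm.1 hx⟩
  · rintro ⟨⟨hQ, h1u⟩, hx⟩
    exact ⟨⟨fun h => hQ (c12.1 h), conn_trans (c1u.2 h1u) (conn_symm h3u)⟩, hXm.2 hx⟩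

/-- Pinned closed: `P(Q ∩ X) = P(Q ∩ X)`. -/
lemma prob_zero_Q_ae {X : Set (Config E)} (hX : FreeAE p f X) :
    prob (Function.update p f 0) (avoidAll ends a₂ {a₁} ∩ X) =
      prob p (avoidAll ends a₂ {a₁} ∩ X) := by
  rw [prob_update_zero_eq]
  exact prob_congr_of_weight p _ _ fun ω hw =>
    and_congr (freeAE_Q hK hf hz hu hf1 h1 h2 ω hw false) (hX ω hw false)

/-- Pinned open: `P(Q ∩ X) = P(Q ∩ X)`. -/
lemma prob_one_Q_ae {X : Set (Config E)} (hX : FreeAE p f X) :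
    prob (Function.update p f 1) (avoidAll ends a₂ {a₁} ∩ X) =
      prob p (avoidAll ends a₂ {a₁} ∩ X) := by
  rw [prob_update_one_eq]
  exact prob_congr_of_weight p _ _ fun ω hw =>
    and_congr (freeAE_Q hK hf hz hu hf1 h1 h2 ω hw true) (hX ω hw true)

end Masses

/-! ## The twelve masses at each pin, collected -/

section Pins

variable {V : Type*} {E : Type*} [Fintype E] [DecidableEq E] {R : Type*} [Field R]
  [LinearOrder R] [IsStrictOrderedRing R]

/-- The twelve masses of `B1` / `B2` at the pin `p[f↦0]` of a pendant cluster: `K` is isolated a.s. -/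
theorem pins_zero_cluster (p : E → R) {ends : E → Sym2 V} {f : E} {o a₁ a₂ a₃ b z u : V}
    (hK : ∀ e ∈ fracEdges p, TouchesReach p ends a₃ e → e = f) (hf : ends f = s(z, u))
    (hz : z ∈ pinnedReach p ends a₃) (hu : u ∉ pinnedReach p ends a₃) (hf1 : p f ≠ 1)
    (h1 : a₁ ∉ pinnedReach p ends a₃) (h2 : a₂ ∉ pinnedReach p ends a₃)
    (ho : o ∉ pinnedReach p ends a₃) (hb : b ∉ pinnedReach p ends a₃) :
    prob (Function.update p f 0) (avoidAll ends a₂ {a₁}) = prob p (avoidAll ends a₂ {a₁}) ∧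
    prob (Function.update p f 0) (PDEvent ends a₁ a₂ a₃) = prob p (avoidAll ends a₂ {a₁}) ∧
    Do (Function.update p f 0) ends o a₁ a₂ a₃ =
      prob p (avoidAll ends a₂ {a₁} ∩ connEvent ends a₁ o) +
        prob p (avoidAll ends a₂ {a₁} ∩ connEvent ends a₂ o) ∧
    EQbo (Function.update p f 0) ends o a₁ a₂ b = EQbo p ends o a₁ a₂ b ∧
    EQb3 (Function.update p f 0) ends a₁ a₂ a₃ b = 0 ∧
    EQb3o (Function.update p f 0) ends o a₁ a₂ a₃ b = 0 ∧
    EQo (Function.update p f 0) ends o a₁ a₂ = EQo p ends o a₁ a₂ ∧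
    EQ3 (Function.update p f 0) ends a₁ a₂ a₃ = 0 ∧
    EQ3o (Function.update p f 0) ends o a₁ a₂ a₃ = 0 ∧
    PDb (Function.update p f 0) ends a₁ a₂ a₃ b =
      prob p (avoidAll ends a₂ {a₁} ∩ connEvent ends a₁ b) +
        prob p (avoidAll ends a₂ {a₁} ∩ connEvent ends a₂ b) ∧
    PDbo (Function.update p f 0) ends o a₁ a₂ a₃ b =
      prob p (avoidAll ends a₂ {a₁} ∩ (connEvent ends a₁ o ∩ connEvent ends a₁ b)) +
        prob p (avoidAll ends a₂ {a₁} ∩ (connEvent ends a₂ o ∩ connEvent ends a₁ b)) +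
        prob p (avoidAll ends a₂ {a₁} ∩ (connEvent ends a₁ o ∩ connEvent ends a₂ b)) +
        prob p (avoidAll ends a₂ {a₁} ∩ (connEvent ends a₂ o ∩ connEvent ends a₂ b)) ∧
    gap (Function.update p f 0) ends a₁ a₂ b = gap p ends a₁ a₂ b := by
  have funiv : FreeAE p f (Set.univ : Set (Config E)) := FreeAE.univ
  have fo1 : FreeAE p f (connEvent ends a₁ o) := freeAE_connEvent hK hf hz hu hf1 h1 ho
  have fo2 : FreeAE p f (connEvent ends a₂ o) := freeAE_connEvent hK hf hz hu hf1 h2 ho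
  have fb1 : FreeAE p f (connEvent ends a₁ b) := freeAE_connEvent hK hf hz hu hf1 h1 hb
  have fb2 : FreeAE p f (connEvent ends a₂ b) := freeAE_connEvent hK hf hz hu hf1 h2 hb
  have f11 : FreeAE p f (connEvent ends a₁ o ∩ connEvent ends a₁ b) := fo1.inter fb1
  have f22 : FreeAE p f (connEvent ends a₂ o ∩ connEvent ends a₂ b) := fo2.inter fb2
  have f21 : FreeAE p f (connEvent ends a₂ o ∩ connEvent ends a₁ b) := fo2.inter fb1
  have f12 : FreeAE p f (connEvent ends a₁ o ∩ connEvent ends a₂ b) := fo1.inter fb2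
  -- pin 0: the leaf is isolated
  have hQ0 : prob (Function.update p f 0) (avoidAll ends a₂ {a₁}) = prob p (avoidAll ends a₂ {a₁}) := by
    have := prob_zero_Q_ae p a₁ a₂ hK hf hz hu hf1 h1 h2 funiv; simpa only [Set.inter_univ] using this
  have hD0 : prob (Function.update p f 0) (PDEvent ends a₁ a₂ a₃) = prob p (avoidAll ends a₂ {a₁}) := by
    have := prob_zero_PD_ae p a₁ a₂ hK hf hz hu hf1 h1 h2 funiv; simpa only [Set.inter_univ] using this
  have hT0 : prob (Function.update p f 0) (TEvent ends a₁ a₂ a₃) = 0 := by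
    have := prob_zero_T_ae p a₁ a₂ hK hf1 h2 Set.univ; simpa only [Set.inter_univ] using this
  have hT'0 : prob (Function.update p f 0) (TEvent ends a₂ a₁ a₃) = 0 := by
    have := prob_zero_T'_ae p a₁ a₂ hK hf1 h1 Set.univ; simpa only [Set.inter_univ] using this
  have hDo0 : Do (Function.update p f 0) ends o a₁ a₂ a₃ =
      prob p (avoidAll ends a₂ {a₁} ∩ connEvent ends a₁ o) + prob p (avoidAll ends a₂ {a₁} ∩ connEvent ends a₂ o) := by
    unfold Do; rw [prob_zero_PD_ae p a₁ a₂ hK hf hz hu hf1 h1 h2 fo1, prob_zero_PD_ae p a₁ a₂ hK hf hz hu hf1 h1 h2 fo2]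
  have hEQbo0 : EQbo (Function.update p f 0) ends o a₁ a₂ b = EQbo p ends o a₁ a₂ b := by
    unfold EQbo; rw [prob_zero_Q_ae p a₁ a₂ hK hf hz hu hf1 h1 h2 f11, prob_zero_Q_ae p a₁ a₂ hK hf hz hu hf1 h1 h2 f22, prob_zero_Q_ae p a₁ a₂ hK hf hz hu hf1 h1 h2 f21, prob_zero_Q_ae p a₁ a₂ hK hf hz hu hf1 h1 h2 f12]
  have hEQb3_0 : EQb3 (Function.update p f 0) ends a₁ a₂ a₃ b = 0 := by
    unfold EQb3; simp only [prob_zero_T_ae p a₁ a₂ hK hf1 h2, prob_zero_T'_ae p a₁ a₂ hK hf1 h1, add_zero, sub_zero]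
  have hEQb3o0 : EQb3o (Function.update p f 0) ends o a₁ a₂ a₃ b = 0 := by
    unfold EQb3o; simp only [prob_zero_T_ae p a₁ a₂ hK hf1 h2, prob_zero_T'_ae p a₁ a₂ hK hf1 h1, add_zero, sub_zero]
  have hEQo0 : EQo (Function.update p f 0) ends o a₁ a₂ = EQo p ends o a₁ a₂ := by
    unfold EQo; rw [prob_zero_Q_ae p a₁ a₂ hK hf hz hu hf1 h1 h2 fo1, prob_zero_Q_ae p a₁ a₂ hK hf hz hu hf1 h1 h2 fo2]
  have hEQ3_0 : EQ3 (Function.update p f 0) ends a₁ a₂ a₃ = 0 := by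
    unfold EQ3; rw [hT0, hT'0]; ring
  have hEQ3o0 : EQ3o (Function.update p f 0) ends o a₁ a₂ a₃ = 0 := by
    unfold EQ3o; simp only [prob_zero_T_ae p a₁ a₂ hK hf1 h2, prob_zero_T'_ae p a₁ a₂ hK hf1 h1, add_zero, sub_zero]
  have hPDb0 : PDb (Function.update p f 0) ends a₁ a₂ a₃ b =
      prob p (avoidAll ends a₂ {a₁} ∩ connEvent ends a₁ b) + prob p (avoidAll ends a₂ {a₁} ∩ connEvent ends a₂ b) := by
    unfold PDb; rw [prob_zero_PD_ae p a₁ a₂ hK hf hz hu hf1 h1 h2 fb1, prob_zero_PD_ae p a₁ a₂ hK hf hz hu hf1 h1 h2 fb2]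
  have hPDbo0 : PDbo (Function.update p f 0) ends o a₁ a₂ a₃ b =
      prob p (avoidAll ends a₂ {a₁} ∩ (connEvent ends a₁ o ∩ connEvent ends a₁ b)) +
        prob p (avoidAll ends a₂ {a₁} ∩ (connEvent ends a₂ o ∩ connEvent ends a₁ b)) +
        prob p (avoidAll ends a₂ {a₁} ∩ (connEvent ends a₁ o ∩ connEvent ends a₂ b)) +
        prob p (avoidAll ends a₂ {a₁} ∩ (connEvent ends a₂ o ∩ connEvent ends a₂ b)) := by
    unfold PDbo; rw [prob_zero_PD_ae p a₁ a₂ hK hf hz hu hf1 h1 h2 f11, prob_zero_PD_ae p a₁ a₂ hK hf hz hu hf1 h1 h2 f21, prob_zero_PD_ae p a₁ a₂ hK hf hz hu hf1 h1 h2 f12, prob_zero_PD_ae p a₁ a₂ hK hf hz hu hf1 h1 h2 f22]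
  have hgap0 : gap (Function.update p f 0) ends a₁ a₂ b = gap p ends a₁ a₂ b := by
    rw [gap_eq_Q, gap_eq_Q, prob_zero_Q_ae p a₁ a₂ hK hf hz hu hf1 h1 h2 fb2, prob_zero_Q_ae p a₁ a₂ hK hf hz hu hf1 h1 h2 fb1]
  exact ⟨hQ0, hD0, hDo0, hEQbo0, hEQb3_0, hEQb3o0, hEQo0, hEQ3_0, hEQ3o0, hPDb0, hPDbo0, hgap0⟩

/-- The twelve masses at the pin `p[f↦1]`: `a₃` is joined to `u` a.s. -/
theorem pins_one_cluster (p : E → R) {ends : E → Sym2 V} {f : E} {o a₁ a₂ a₃ b z u : V}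
    (hK : ∀ e ∈ fracEdges p, TouchesReach p ends a₃ e → e = f) (hf : ends f = s(z, u))
    (hz : z ∈ pinnedReach p ends a₃) (hu : u ∉ pinnedReach p ends a₃) (hf1 : p f ≠ 1)
    (h1 : a₁ ∉ pinnedReach p ends a₃) (h2 : a₂ ∉ pinnedReach p ends a₃)
    (ho : o ∉ pinnedReach p ends a₃) (hb : b ∉ pinnedReach p ends a₃) :
    prob (Function.update p f 1) (avoidAll ends a₂ {a₁}) = prob p (avoidAll ends a₂ {a₁}) ∧
    prob (Function.update p f 1) (PDEvent ends a₁ a₂ a₃) = prob p (PDEvent ends a₁ a₂ u) ∧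
    Do (Function.update p f 1) ends o a₁ a₂ a₃ = Do p ends o a₁ a₂ u ∧
    EQbo (Function.update p f 1) ends o a₁ a₂ b = EQbo p ends o a₁ a₂ b ∧
    EQb3 (Function.update p f 1) ends a₁ a₂ a₃ b = EQb3 p ends a₁ a₂ u b ∧
    EQb3o (Function.update p f 1) ends o a₁ a₂ a₃ b = EQb3o p ends o a₁ a₂ u b ∧
    EQo (Function.update p f 1) ends o a₁ a₂ = EQo p ends o a₁ a₂ ∧
    EQ3 (Function.update p f 1) ends a₁ a₂ a₃ = EQ3 p ends a₁ a₂ u ∧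
    EQ3o (Function.update p f 1) ends o a₁ a₂ a₃ = EQ3o p ends o a₁ a₂ u ∧
    PDb (Function.update p f 1) ends a₁ a₂ a₃ b = PDb p ends a₁ a₂ u b ∧
    PDbo (Function.update p f 1) ends o a₁ a₂ a₃ b = PDbo p ends o a₁ a₂ u b ∧
    gap (Function.update p f 1) ends a₁ a₂ b = gap p ends a₁ a₂ b := by
  have funiv : FreeAE p f (Set.univ : Set (Config E)) := FreeAE.univ
  have fo1 : FreeAE p f (connEvent ends a₁ o) := freeAE_connEvent hK hf hz hu hf1 h1 ho
  have fo2 : FreeAE p f (connEvent ends a₂ o) := freeAE_connEvent hK hf hz hu hf1 h2 ho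
  have fb1 : FreeAE p f (connEvent ends a₁ b) := freeAE_connEvent hK hf hz hu hf1 h1 hb
  have fb2 : FreeAE p f (connEvent ends a₂ b) := freeAE_connEvent hK hf hz hu hf1 h2 hb
  have f11 : FreeAE p f (connEvent ends a₁ o ∩ connEvent ends a₁ b) := fo1.inter fb1
  have f22 : FreeAE p f (connEvent ends a₂ o ∩ connEvent ends a₂ b) := fo2.inter fb2
  have f21 : FreeAE p f (connEvent ends a₂ o ∩ connEvent ends a₁ b) := fo2.inter fb1
  have f12 : FreeAE p f (connEvent ends a₁ o ∩ connEvent ends a₂ b) := fo1.inter fb2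
  -- pin 1: the leaf is identified with `u`
  have hQ1 : prob (Function.update p f 1) (avoidAll ends a₂ {a₁}) = prob p (avoidAll ends a₂ {a₁}) := by
    have := prob_one_Q_ae p a₁ a₂ hK hf hz hu hf1 h1 h2 funiv; simpa only [Set.inter_univ] using this
  have hD1 : prob (Function.update p f 1) (PDEvent ends a₁ a₂ a₃) =
      prob p (PDEvent ends a₁ a₂ u) := by
    have := prob_one_PD_ae p a₁ a₂ hK hf hz hu hf1 h1 h2 funiv; simpa only [Set.inter_univ] using this
  have hT1 : prob (Function.update p f 1) (TEvent ends a₁ a₂ a₃) = prob p (TEvent ends a₁ a₂ u) := by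
    have := prob_one_T_ae p a₁ a₂ hK hf hz hu hf1 h1 h2 funiv; simpa only [Set.inter_univ] using this
  have hT'1 : prob (Function.update p f 1) (TEvent ends a₂ a₁ a₃) =
      prob p (TEvent ends a₂ a₁ u) := by
    have := prob_one_T'_ae p a₁ a₂ hK hf hz hu hf1 h1 h2 funiv; simpa only [Set.inter_univ] using this
  have hDo1 : Do (Function.update p f 1) ends o a₁ a₂ a₃ = Do p ends o a₁ a₂ u := by
    unfold Do; rw [prob_one_PD_ae p a₁ a₂ hK hf hz hu hf1 h1 h2 fo1, prob_one_PD_ae p a₁ a₂ hK hf hz hu hf1 h1 h2 fo2]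
  have hEQbo1 : EQbo (Function.update p f 1) ends o a₁ a₂ b = EQbo p ends o a₁ a₂ b := by
    unfold EQbo; rw [prob_one_Q_ae p a₁ a₂ hK hf hz hu hf1 h1 h2 f11, prob_one_Q_ae p a₁ a₂ hK hf hz hu hf1 h1 h2 f22, prob_one_Q_ae p a₁ a₂ hK hf hz hu hf1 h1 h2 f21, prob_one_Q_ae p a₁ a₂ hK hf hz hu hf1 h1 h2 f12]
  have hEQb3_1 : EQb3 (Function.update p f 1) ends a₁ a₂ a₃ b = EQb3 p ends a₁ a₂ u b := by
    unfold EQb3; rw [prob_one_T'_ae p a₁ a₂ hK hf hz hu hf1 h1 h2 fb1, prob_one_T_ae p a₁ a₂ hK hf hz hu hf1 h1 h2 fb2, prob_one_T_ae p a₁ a₂ hK hf hz hu hf1 h1 h2 fb1, prob_one_T'_ae p a₁ a₂ hK hf hz hu hf1 h1 h2 fb2]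
  have hEQb3o1 : EQb3o (Function.update p f 1) ends o a₁ a₂ a₃ b = EQb3o p ends o a₁ a₂ u b := by
    unfold EQb3o
    simp only [prob_one_T'_ae p a₁ a₂ hK hf hz hu hf1 h1 h2 f11, prob_one_T'_ae p a₁ a₂ hK hf hz hu hf1 h1 h2 f21, prob_one_T_ae p a₁ a₂ hK hf hz hu hf1 h1 h2 f12, prob_one_T_ae p a₁ a₂ hK hf hz hu hf1 h1 h2 f22, prob_one_T_ae p a₁ a₂ hK hf hz hu hf1 h1 h2 f11, prob_one_T_ae p a₁ a₂ hK hf hz hu hf1 h1 h2 f21, prob_one_T'_ae p a₁ a₂ hK hf hz hu hf1 h1 h2 f12,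
      prob_one_T'_ae p a₁ a₂ hK hf hz hu hf1 h1 h2 f22]
  have hEQo1 : EQo (Function.update p f 1) ends o a₁ a₂ = EQo p ends o a₁ a₂ := by
    unfold EQo; rw [prob_one_Q_ae p a₁ a₂ hK hf hz hu hf1 h1 h2 fo1, prob_one_Q_ae p a₁ a₂ hK hf hz hu hf1 h1 h2 fo2]
  have hEQ3_1 : EQ3 (Function.update p f 1) ends a₁ a₂ a₃ = EQ3 p ends a₁ a₂ u := by
    unfold EQ3; rw [hT'1, hT1]
  have hEQ3o1 : EQ3o (Function.update p f 1) ends o a₁ a₂ a₃ = EQ3o p ends o a₁ a₂ u := by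
    unfold EQ3o; simp only [prob_one_T'_ae p a₁ a₂ hK hf hz hu hf1 h1 h2 fo1, prob_one_T'_ae p a₁ a₂ hK hf hz hu hf1 h1 h2 fo2, prob_one_T_ae p a₁ a₂ hK hf hz hu hf1 h1 h2 fo1, prob_one_T_ae p a₁ a₂ hK hf hz hu hf1 h1 h2 fo2]
  have hPDb1 : PDb (Function.update p f 1) ends a₁ a₂ a₃ b = PDb p ends a₁ a₂ u b := by
    unfold PDb; rw [prob_one_PD_ae p a₁ a₂ hK hf hz hu hf1 h1 h2 fb1, prob_one_PD_ae p a₁ a₂ hK hf hz hu hf1 h1 h2 fb2]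
  have hPDbo1 : PDbo (Function.update p f 1) ends o a₁ a₂ a₃ b = PDbo p ends o a₁ a₂ u b := by
    unfold PDbo; simp only [prob_one_PD_ae p a₁ a₂ hK hf hz hu hf1 h1 h2 f11, prob_one_PD_ae p a₁ a₂ hK hf hz hu hf1 h1 h2 f21, prob_one_PD_ae p a₁ a₂ hK hf hz hu hf1 h1 h2 f12, prob_one_PD_ae p a₁ a₂ hK hf hz hu hf1 h1 h2 f22]
  have hgap1 : gap (Function.update p f 1) ends a₁ a₂ b = gap p ends a₁ a₂ b := by
    rw [gap_eq_Q, gap_eq_Q, prob_one_Q_ae p a₁ a₂ hK hf hz hu hf1 h1 h2 fb2, prob_one_Q_ae p a₁ a₂ hK hf hz hu hf1 h1 h2 fb1]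
  exact ⟨hQ1, hD1, hDo1, hEQbo1, hEQb3_1, hEQb3o1, hEQo1, hEQ3_1, hEQ3o1, hPDb1, hPDbo1, hgap1⟩

end Pins

end PendantCluster

end Summit.Ventures.PercRepro2
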